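import Literature.NumberTheory.EllipticCurves.NonvanishingTwistsWaldspurgerOfHoffsteinLuo
import Literature.NumberTheory.EllipticCurves.NonvanishingTwistsPrescribedSplitting
import HarnessLib

/-!
# Friedberg–Hoffstein's finite-set split prescription from Modularity and Hoffstein–Luo

The named fact
`Literature.NumberTheory.EllipticCurves.friedbergHoffstein_exists_heegnerField_splitDivisors_twist_ne_zero`
(`NonvanishingTwistsPrescribedSplitting.lean`; Friedberg–Hoffstein 1995, Thm. B, in the special case
used by Jetchev–Skinner–Wan 2017 §7.4.1–7.4.2 and Burungale–Skinner–Tian–Wan 2024, proof of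
Thm. 4.3: for `E/ℚ` with `w(E) = −1`, every `M ≠ 0` and every bound `B` an imaginary quadratic `K`,
`|d_K| > B`, with every prime of `N_E` AND every prime of `M` split in `K` and `L(E^{(d_K)}, 1) ≠ 0`)
is the ROOT of the tree's split-prescription family: it implies the one-prime form
`friedbergHoffstein_exists_heegnerField_split_twist_ne_zero` (`…_of_splitDivisors`) and Waldspurger's
`waldspurger_exists_heegnerField_twist_ne_zero` (`waldspurger_…_of_splitDivisors`). The sibling module
`NonvanishingTwistsWaldspurgerOfHoffsteinLuo` proves those two CONSEQUENCES from

* `exists_isNewformOf` — the Modularity Theorem (BCDT 2001, Thm. A), and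
* `HoffsteinLuo1997_exists_twist_L_one_ne_zero` — Hoffstein–Luo 1997, Theorem with its "moreover"
  clause: for every `E/ℚ`, finite `S`, bound `B` a square-free `d ≡ 1 (mod 8)`, `|d| > B`, at most
  `4` prime factors, `(d/ℓ) = 1` for the odd `ℓ ∈ S`, `L(E^{(d)}, 1) ≠ 0`;

this module proves the ROOT itself from the same two inputs
(`friedbergHoffstein_exists_heegnerField_splitDivisors_twist_ne_zero_of_hoffsteinLuo`), by the same
argument with Hoffstein–Luo's set `S` taken to be the primes of `N_E · M`: the sign of the
functional equation of `L(E ⊗ χ_d, s)` for `d > 0` with every `ℓ ∣ N_E` split is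
`w(E) χ_d(−N_E) = −1` (Murty–Murty 1997, Ch. 6 §1, p. 96;
`entireLFunction_quadraticTwist_one_eq_zero_of_pos`), so `L(E^{(d)}, 1) ≠ 0` forces `d < 0`, and
`K = ℚ(√d)` is imaginary quadratic of discriminant `d` with the primes of `N_E · M` split
(`exists_heegnerField_iff_exists_fundamental`).

The argument never uses Hoffstein–Luo's bound on the number of prime factors of `d`. It is
therefore written once for an arbitrary supply of such twists
(`friedbergHoffstein_exists_heegnerField_splitDivisors_twist_ne_zero_of_twists`) and for the
Hoffstein–Luo shape with any bound `r` on `ω(d)` (`…_of_card_le`): with `r = 4` this is the named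
fact `HoffsteinLuo1997_exists_twist_L_one_ne_zero`; with `r = 20` it is the conclusion of
`HoffsteinLuo1997.forall_exists_twist_card_le_twenty_of_RS2015_prop2`
(`NonvanishingTwistsHoffsteinLuoMomentProofs.lean`), i.e. the road through Radziwiłł–Soundararajan
2015, Proposition 2 (whose proof is complete in print) and `L(½, E_d) ≥ 0`.

Consequence for provenance: every member of the split-prescription family —
`…splitDivisors…` (this file), `…split_twist_ne_zero` and `waldspurger_…` (sibling module), and the
consumer shapes `exists_heegnerField_split_two_split_oddDiscr_twist_ne_zero` /
`exists_heegnerField_split_two_primes_twist_ne_zero` (here, `…_of_hoffsteinLuo`) — is a THEOREM given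
Modularity and Hoffstein–Luo; only the RAMIFIED and INERT prescriptions
(`friedbergHoffstein_exists_twist_ne_zero_ramifiedAt`, `…_inertAt`, `…_ramifiedAt_splitAt`) rest on
Friedberg–Hoffstein 1995 by name alone (Hoffstein–Luo's theorem prescribes `χ_d(ℓ) = +1` only).

Everything here is proved; no definitions and no named facts are introduced (D-0026).

## References

* [FriedbergHoffstein1995] S. Friedberg, J. Hoffstein, Ann. of Math. 142 (1995) 385–423, Thm. B.
* [HoffsteinLuo1997] J. Hoffstein, W. Luo, Math. Res. Lett. 4 (1997) 435–442, Theorem (§1).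
* [MurtyMurty1997] M. R. Murty, V. K. Murty, *Non-vanishing of `L`-functions and applications*,
  Progress in Math. 157 (1997), Ch. 6 §1, p. 96.
* [JetchevSkinnerWan2017] D. Jetchev, C. Skinner, X. Wan, Camb. J. Math. 5 (2017), §7.4.1–7.4.2.
* [BurungaleSkinnerTianWan2024] A. Burungale, C. Skinner, Y. Tian, X. Wan, arXiv:2409.01350,
  Part II, proof of Thm. 4.3.
* [RadziwillSoundararajan2015] M. Radziwiłł, K. Soundararajan, Invent. Math. 202 (2015), §2 Prop. 2.
* [BCDTJAMS2001] C. Breuil, B. Conrad, F. Diamond, R. Taylor, JAMS 14 (2001), Thm. A.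
-/

noncomputable section

open WeierstrassCurve

open Literature.NumberTheory.EllipticCurves.ModularForms (exists_isNewformOf)

namespace Literature.NumberTheory.EllipticCurves

/-! ### The sign obstruction for an arbitrary supply of twists with prescribed residue symbols -/

/-- **A non-vanishing twist with prescribed `(d/ℓ) = +1` is negative when `w(E) = −1`** — the
content of `exists_neg_fundamental_twist_ne_zero_of_hoffsteinLuo` for ANY supply `hTw` of
square-free `d ≡ 1 (mod 8)`, `|d| > B`, `(d/ℓ) = 1` at the odd primes of a prescribed finite set,
with `L(E^{(d)}, 1) ≠ 0` (no bound on the number of prime factors of `d` is used): applied with the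
primes of `N_E` adjoined to `S`, the sign of the functional equation (Murty–Murty 1997, Ch. 6 §1,
p. 96; `entireLFunction_quadraticTwist_one_eq_zero_of_pos`, from Modularity) forces `d < 0`.
[cite: MurtyMurty1997, Ch. 6 §1, p. 96] [cite: HoffsteinLuo1997, Theorem (§1, pp. 435–436)] -/
theorem exists_neg_fundamental_twist_ne_zero_of_twists (hmod : exists_isNewformOf)
    (hTw : ∀ (W : WeierstrassCurve ℚ) [W.IsElliptic] (S : Finset ℕ) (B : ℕ),
      ∃ d : ℤ, B < d.natAbs ∧ Squarefree d ∧ d % 8 = 1 ∧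
        (∀ p ∈ S, p.Prime → p ≠ 2 → jacobiSym d p = 1) ∧
          (W.quadraticTwist (d : ℚ)).entireLFunction 1 ≠ 0)
    (W : WeierstrassCurve ℚ) [W.IsElliptic] (hw : W.rootNumber = -1) (S : Finset ℕ) (B : ℕ) :
    ∃ d : ℤ, d < 0 ∧ Squarefree d ∧ d % 8 = 1 ∧ B < d.natAbs ∧
      (∀ p ∈ S, p.Prime → p ≠ 2 → jacobiSym d p = 1) ∧
      (∀ p : ℕ, p.Prime → p ∣ W.conductorNorm ℤ → p ≠ 2 → jacobiSym d p = 1) ∧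
      (W.quadraticTwist (d : ℚ)).entireLFunction 1 ≠ 0 := by
  have hN0 : W.conductorNorm ℤ ≠ 0 := (W.conductorNorm_pos_holds).ne'
  obtain ⟨d, hBd, hsq, hd8, hjac, hL⟩ := hTw W (S ∪ (W.conductorNorm ℤ).primeFactors) B
  have hjacN : ∀ p : ℕ, p.Prime → p ∣ W.conductorNorm ℤ → p ≠ 2 → jacobiSym d p = 1 :=
    fun p hp hpN hp2 ↦
      hjac p (Finset.mem_union_right _ (Nat.mem_primeFactors.mpr ⟨hp, hpN, hN0⟩)) hp hp2
  have hjacS : ∀ p ∈ S, p.Prime → p ≠ 2 → jacobiSym d p = 1 :=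
    fun p hp ↦ hjac p (Finset.mem_union_left _ hp)
  have hdneg : d < 0 := by
    rcases lt_trichotomy d 0 with h | h | h
    · exact h
    · exact absurd h hsq.ne_zero
    · exact absurd (entireLFunction_quadraticTwist_one_eq_zero_of_pos hmod W hw h hsq (by omega)
        (fun _ ↦ hd8) hjacN) hL
  exact ⟨d, hdneg, hsq, hd8, hBd, hjacS, hjacN, hL⟩

/-! ### The root of the split-prescription family from Modularity and a supply of twists -/

/-- **Friedberg–Hoffstein's finite-set split prescription from Modularity and ANY supply of
non-vanishing twists with prescribed residue symbols `+1`.** If for every elliptic `W/ℚ`, finite `S`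
and bound `B` there is a square-free `d ≡ 1 (mod 8)`, `|d| > B`, with `(d/ℓ) = 1` for the odd
`ℓ ∈ S` and `L(W^{(d)}, 1) ≠ 0`, then for `w(W) = −1`, `M ≠ 0` and `B` there is an imaginary
quadratic `K`, `|d_K| > B`, in which every prime of `N_W` and every prime of `M` splits, with
`L(W^{(d_K)}, 1) ≠ 0`: take `S` = the primes of `M` (the primes of `N_W` are adjoined by
`exists_neg_fundamental_twist_ne_zero_of_twists`), so `d < 0` by the sign obstruction, and
`K = ℚ(√d)` (`exists_heegnerField_iff_exists_fundamental` at level `N_W · M`, then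
`SatisfiesHeegnerHypothesis.of_dvd` for the two factors).
[cite: FriedbergHoffstein1995, Thm. B] [cite: JetchevSkinnerWan2017, §7.4.1 (p. 30), §7.4.2 (p. 31)]
[cite: MurtyMurty1997, Ch. 6 §1, p. 96] -/
theorem friedbergHoffstein_exists_heegnerField_splitDivisors_twist_ne_zero_of_twists
    (hmod : exists_isNewformOf)
    (hTw : ∀ (W : WeierstrassCurve ℚ) [W.IsElliptic] (S : Finset ℕ) (B : ℕ),
      ∃ d : ℤ, B < d.natAbs ∧ Squarefree d ∧ d % 8 = 1 ∧
        (∀ p ∈ S, p.Prime → p ≠ 2 → jacobiSym d p = 1) ∧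
          (W.quadraticTwist (d : ℚ)).entireLFunction 1 ≠ 0) :
    friedbergHoffstein_exists_heegnerField_splitDivisors_twist_ne_zero := by
  intro W _ hw M hM B
  obtain ⟨d, hdneg, hsq, hd8, hBd, hjacS, hjacN, hL⟩ :=
    exists_neg_fundamental_twist_ne_zero_of_twists hmod hTw W hw M.primeFactors B
  have hkr : ∀ q : ℕ, q.Prime → q ∣ W.conductorNorm ℤ * M →
      (q = 2 → d % 8 = 1) ∧ (q ≠ 2 → jacobiSym d q = 1) := by
    intro q hq hqNM
    refine ⟨fun _ ↦ hd8, fun hq2 ↦ ?_⟩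
    rcases (Nat.Prime.dvd_mul hq).mp hqNM with hqN | hqM
    · exact hjacN q hq hqN hq2
    · exact hjacS q (Nat.mem_primeFactors.mpr ⟨hq, hqM, hM⟩) hq hq2
  obtain ⟨K, _, _, hK, hB, hH, hLK⟩ :=
    (exists_heegnerField_iff_exists_fundamental (W.conductorNorm ℤ * M) B
      (fun D ↦ (W.quadraticTwist (D : ℚ)).entireLFunction 1 ≠ 0)).mpr
      ⟨d, hdneg, Or.inl ⟨by omega, hsq, by omega⟩, hBd, hkr, hL⟩
  exact ⟨K, _, _, hK, hB, hH.of_dvd (dvd_mul_right _ _), hH.of_dvd (dvd_mul_left _ _), hLK⟩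

/-- **The same from a Hoffstein–Luo-shaped supply with ANY bound `r` on the number of prime
factors** (the bound is discarded): `r = 4` is Hoffstein–Luo 1997, Theorem
(`HoffsteinLuo1997_exists_twist_L_one_ne_zero`, next theorem); `r = 20` is the conclusion of
`HoffsteinLuo1997.forall_exists_twist_card_le_twenty_of_RS2015_prop2`
(`NonvanishingTwistsHoffsteinLuoMomentProofs.lean`: Radziwiłł–Soundararajan 2015, Prop. 2,
transcribed, and `L(½, E_d) ≥ 0`), so the finite-set split prescription also follows along that
road by `…_of_card_le 20`. [cite: HoffsteinLuo1997, Theorem (§1, pp. 435–436)]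
[cite: RadziwillSoundararajan2015, §2 Proposition 2] [cite: FriedbergHoffstein1995, Thm. B] -/
theorem friedbergHoffstein_exists_heegnerField_splitDivisors_twist_ne_zero_of_card_le (r : ℕ)
    (hmod : exists_isNewformOf)
    (hr : ∀ (W : WeierstrassCurve ℚ) [W.IsElliptic] (S : Finset ℕ) (Bd : ℕ),
      ∃ d : ℤ, Bd < d.natAbs ∧ Squarefree d ∧ d % 8 = 1 ∧ d.natAbs.primeFactors.card ≤ r ∧
        (∀ p ∈ S, p.Prime → p ≠ 2 → jacobiSym d p = 1) ∧
          (W.quadraticTwist (d : ℚ)).entireLFunction 1 ≠ 0) :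
    friedbergHoffstein_exists_heegnerField_splitDivisors_twist_ne_zero :=
  friedbergHoffstein_exists_heegnerField_splitDivisors_twist_ne_zero_of_twists hmod
    fun W _ S B ↦ by
      obtain ⟨d, hBd, hsq, hd8, -, hjac, hL⟩ := hr W S B
      exact ⟨d, hBd, hsq, hd8, hjac, hL⟩

/-! ### The named fact and its consumer shapes from Modularity and Hoffstein–Luo -/

/-- **Friedberg–Hoffstein's non-vanishing twist with prescribed splitting at the primes of an
arbitrary auxiliary integer, from the Modularity Theorem and Hoffstein–Luo 1997.** The named fact
`friedbergHoffstein_exists_heegnerField_splitDivisors_twist_ne_zero` (Friedberg–Hoffstein 1995,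
Thm. B, as used by Jetchev–Skinner–Wan 2017 §7.4.1–7.4.2 and Burungale–Skinner–Tian–Wan 2024,
proof of Thm. 4.3) holds assuming `exists_isNewformOf` (BCDT 2001, Thm. A) and
`HoffsteinLuo1997_exists_twist_L_one_ne_zero` (Hoffstein–Luo 1997, Theorem, "moreover" clause with
`S` = the primes of `N_E · M`); the sign of `d` is forced by the functional equation of the twist
(Murty–Murty 1997, Ch. 6 §1, p. 96). [cite: FriedbergHoffstein1995, Thm. B]
[cite: HoffsteinLuo1997, Theorem (§1, pp. 435–436)] [cite: MurtyMurty1997, Ch. 6 §1, p. 96]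
[cite: JetchevSkinnerWan2017, §7.4.1 (p. 30), §7.4.2 (p. 31)] -/
theorem friedbergHoffstein_exists_heegnerField_splitDivisors_twist_ne_zero_of_hoffsteinLuo
    (hmod : exists_isNewformOf) (hHL : HoffsteinLuo1997_exists_twist_L_one_ne_zero) :
    friedbergHoffstein_exists_heegnerField_splitDivisors_twist_ne_zero :=
  friedbergHoffstein_exists_heegnerField_splitDivisors_twist_ne_zero_of_card_le 4 hmod
    fun W _ S B ↦ hHL W S B

/-- **The whole split-prescription family at once.** Assuming Modularity and Hoffstein–Luo 1997,
the three named facts with split-type prescriptions — the finite-set form (this file), the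
one-prime form `friedbergHoffstein_exists_heegnerField_split_twist_ne_zero` and Waldspurger's
`waldspurger_exists_heegnerField_twist_ne_zero` (both through `…_of_splitDivisors`,
`NonvanishingTwistsPrescribedSplitting.lean`; also directly in
`NonvanishingTwistsWaldspurgerOfHoffsteinLuo.lean`) — all hold.
[cite: FriedbergHoffstein1995, Thm. B] [cite: HoffsteinLuo1997, Theorem (§1, pp. 435–436)]
[cite: Darmon2004, §3.9, proof of Thm. 3.22, (1)–(3)] -/
theorem splitPrescribedTwist_facts_of_hoffsteinLuo (hmod : exists_isNewformOf)
    (hHL : HoffsteinLuo1997_exists_twist_L_one_ne_zero) :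
    friedbergHoffstein_exists_heegnerField_splitDivisors_twist_ne_zero ∧
      friedbergHoffstein_exists_heegnerField_split_twist_ne_zero ∧
        waldspurger_exists_heegnerField_twist_ne_zero :=
  have h := friedbergHoffstein_exists_heegnerField_splitDivisors_twist_ne_zero_of_hoffsteinLuo
    hmod hHL
  ⟨h, friedbergHoffstein_exists_heegnerField_split_twist_ne_zero_of_splitDivisors h,
    waldspurger_exists_heegnerField_twist_ne_zero_of_splitDivisors h⟩

/-- **Consumer shape: two prescribed split primes** (`exists_heegnerField_split_two_primes_twist_ne_zero`,
Jetchev–Skinner–Wan 2017 §7.4.1 with `M = p·q`), from Modularity and Hoffstein–Luo.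
[cite: JetchevSkinnerWan2017, §7.4.1 (p. 30)] [cite: HoffsteinLuo1997, Theorem (§1, pp. 435–436)] -/
theorem exists_heegnerField_split_two_primes_twist_ne_zero_of_hoffsteinLuo
    (hmod : exists_isNewformOf) (hHL : HoffsteinLuo1997_exists_twist_L_one_ne_zero)
    (W : WeierstrassCurve ℚ) [W.IsElliptic] (hw : W.rootNumber = -1) {p q : ℕ} (hp : p.Prime)
    (hq : q.Prime) (B : ℕ) :
    ∃ (K : Type) (_ : Field K) (_ : NumberField K),
      IsImaginaryQuadratic K ∧ B < (NumberField.discr K).natAbs ∧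
        SatisfiesHeegnerHypothesis (W.conductorNorm ℤ) K ∧ SatisfiesHeegnerHypothesis p K ∧
          SatisfiesHeegnerHypothesis q K ∧
            (W.quadraticTwist (NumberField.discr K : ℚ)).entireLFunction 1 ≠ 0 :=
  exists_heegnerField_split_two_primes_twist_ne_zero
    (friedbergHoffstein_exists_heegnerField_splitDivisors_twist_ne_zero_of_hoffsteinLuo hmod hHL)
    W hw hp hq B

/-- **Consumer shape: `p` and `2` split, `d_K` odd** (`exists_heegnerField_split_two_split_oddDiscr_twist_ne_zero`,
the "`d_K` odd and prime to `p`" field of Skinner 2020 p. 4 / Jetchev–Skinner–Wan 2017 §7.4.1),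
from Modularity and Hoffstein–Luo. [cite: JetchevSkinnerWan2017, §7.4.1 (p. 30)]
[cite: HoffsteinLuo1997, Theorem (§1, pp. 435–436)] -/
theorem exists_heegnerField_split_two_split_oddDiscr_twist_ne_zero_of_hoffsteinLuo
    (hmod : exists_isNewformOf) (hHL : HoffsteinLuo1997_exists_twist_L_one_ne_zero)
    (W : WeierstrassCurve ℚ) [W.IsElliptic] (hw : W.rootNumber = -1) {p : ℕ} (hp : p.Prime)
    (B : ℕ) :
    ∃ (K : Type) (_ : Field K) (_ : NumberField K),
      IsImaginaryQuadratic K ∧ B < (NumberField.discr K).natAbs ∧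
        SatisfiesHeegnerHypothesis (W.conductorNorm ℤ) K ∧ SatisfiesHeegnerHypothesis p K ∧
          SatisfiesHeegnerHypothesis 2 K ∧ Odd (NumberField.discr K) ∧
            (W.quadraticTwist (NumberField.discr K : ℚ)).entireLFunction 1 ≠ 0 :=
  exists_heegnerField_split_two_split_oddDiscr_twist_ne_zero
    (friedbergHoffstein_exists_heegnerField_splitDivisors_twist_ne_zero_of_hoffsteinLuo hmod hHL)
    W hw hp B

end Literature.NumberTheory.EllipticCurves

end
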